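import Summits.CriticalPhenomena.PercolationContinuityZ3.Theorems.Transplant.SkelPhiTypedCtr
import Summits.CriticalPhenomena.PercolationContinuityZ3.Theorems.Transplant.PlanarSkeletonNegFromDefs
import HarnessLib

/-!
# D″(κ′), base layer: the φ-level dictionary entry `Skelφ.CylConnFrom` ((κ′) = cylinders connected from width `ℓ₀` on) and the FOUR (κ)-consumers
# of the closed cones restated under it — steps (i)–(ii) of the re-parametrisation census P4-GENERAL §34.7

builds on p205010 (kernel theorem, internal audit signed; external expert review pending) — nothing in this file uses p205010; NOTHING is claimed
about the node variant `SamePDropOfSkeletonNegFrom₁` (OPEN).  Lane `prim-bschramm`, seat `prim-bschramm-p4` gen 12 (PART C3); helper file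
(`--supports stmt-CriticalPhenomena-4575 --as helper`).

The closed `(ℤ/2)²` and `{±1}` nodes read the interface field (κ) only through `Skelφ.CylConn G φ types` (`∀ t ∈ types, ∀ ℓ ≥ 1, connected`), and
consume it in exactly four places (census §34.7).  Here: the weakened dictionary entry **`Skelφ.CylConnFrom G φ types ℓ₀`** (`∀ ℓ ≥ ℓ₀`; the type of
the field `PlanarSkeletonNegFrom.cyl_connected`, bridge `PlanarSkeletonNegFrom.cylConnFrom`), `CylConn.toFrom` (`ℓ₀ = 1`), monotonicity in `ℓ₀`,
and the four consumers VERBATIM with `1 ≤ ℓ` replaced by `ℓ₀ ≤ ℓ` (the two internal widths raised by `ℓ₀`):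
`prism_subset_cylBall_of_mem_from`, `prism_subset_cylBall_from`, `graphBall_inter_cyl_subset_cylBall'_from`, `prism_subset_cylBall_of_near_from`
(`SkelPhiCylBall` §5–§6), `fatSeq_exhaust_from` (`SkelPhiFatRadius`), `exists_typeReach_from` (`SkelPhiTypedCtr`; `k₀ ≥ max(1, ℓ₀)`).  What remains
for the planners is step (iii): threading `ℓ, ℓs, m ≥ ℓ₀` through the parameter ledgers of the N1 closure.
[cite: KozmaNitzan2024, §4 p. 19 (the wired cube), p. 20 ((22)–(23))] [cite: BenjaminiSchramm1996, Conj. 4]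
-/

noncomputable section

namespace Summit.CriticalPhenomena.PercolationContinuityZ3.Theorems.Transplant

namespace Skelφ

open Literature.Probability.Percolation Literature.Probability.LatticeModels SimpleGraph
open Literature.Barriers.CriticalPhenomena (graphBall graphBall_finite mem_graphBall_self graphBall_mono)
open scoped Classical

variable {V : Type}

/-! ## §0 The dictionary entry (κ′) -/

/-- **(κ′) connected cylinders from width `ℓ₀` on**: the graph induced on each cylinder of half-width `ℓ ≥ ℓ₀` at a base vertex is connected
(the type of the field `PlanarSkeletonNegFrom.cyl_connected`). [this work] -/
def CylConnFrom (G : SimpleGraph V) (φ : V → Site 2) (types : Finset V) (ℓ₀ : ℕ) : Prop :=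
  ∀ t ∈ types, ∀ ℓ : ℕ, ℓ₀ ≤ ℓ → (G.induce {w | φ w - φ t ∈ box 2 ℓ}).Connected

/-- (κ′) read through `Skelφ.cyl`. [folklore] -/
theorem CylConnFrom.connected {G : SimpleGraph V} {φ : V → Site 2} {types : Finset V} {ℓ₀ : ℕ} (hκ : CylConnFrom G φ types ℓ₀) {t : V}
    (ht : t ∈ types) {ℓ : ℕ} (hℓ : ℓ₀ ≤ ℓ) : (G.induce (cyl φ t ℓ)).Connected :=
  hκ t ht ℓ hℓ

/-- (κ) is (κ′) with `ℓ₀ = 1`. [folklore] -/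
theorem CylConn.toFrom {G : SimpleGraph V} {φ : V → Site 2} {types : Finset V} (hκ : CylConn G φ types) : CylConnFrom G φ types 1 :=
  fun t ht ℓ hℓ => hκ t ht ℓ hℓ

/-- (κ′) is monotone in the width `ℓ₀`. [folklore] -/
theorem CylConnFrom.mono {G : SimpleGraph V} {φ : V → Site 2} {types : Finset V} {ℓ₀ ℓ₁ : ℕ} (h : ℓ₀ ≤ ℓ₁)
    (hκ : CylConnFrom G φ types ℓ₀) : CylConnFrom G φ types ℓ₁ :=
  fun t ht ℓ hℓ => hκ t ht ℓ (h.trans hℓ)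

variable {G : SimpleGraph V} {φ : V → Site 2}

/-! ## §1 The `SkelPhiCylBall` consumers under (κ′) -/

/-- At a BASE vertex (from (κ′)): the prism of radius `ψ` and half-width `ℓ ≥ ℓ₀` lies in the fat prism of radius `cylRadMax ℓ ψ`. [this work] -/
theorem prism_subset_cylBall_of_mem_from [G.LocallyFinite] {types : Finset V} {ℓ₀ : ℕ} (hκ : CylConnFrom G φ types ℓ₀) {t : V}
    (ht : t ∈ types) {ℓ : ℕ} (hℓ : ℓ₀ ≤ ℓ) (ψ : ℕ) : prism G φ t ψ ℓ ⊆ cylBall G φ t ℓ (cylRadMax G φ types ℓ ψ) := fun _ hw =>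
  cylBall_mono G φ t le_rfl (cylRad_le_cylRadMax G φ ht ℓ ψ) (graphBall_inter_cyl_subset_cylBall (hκ.connected ht hℓ) ψ ⟨hw.1, hw.2⟩)

/-- **At EVERY centre** `c` (from `Frames` + (κ′)): `prism c ψ ℓ ⊆ cylBall c ℓ (cylRadMax ℓ ψ)` for `ℓ ≥ ℓ₀`. [this work] -/
theorem prism_subset_cylBall_from [G.LocallyFinite] {types : Finset V} {ℓ₀ : ℕ} (hfr : Frames G φ types) (hκ : CylConnFrom G φ types ℓ₀)
    (c : V) {ℓ : ℕ} (hℓ : ℓ₀ ≤ ℓ) (ψ : ℕ) : prism G φ c ψ ℓ ⊆ cylBall G φ c ℓ (cylRadMax G φ types ℓ ψ) := by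
  obtain ⟨t, ht, α, hαt, hφ⟩ := hfr c
  have h1 : α '' prism G φ t ψ ℓ = prism G φ c ψ ℓ := by
    rw [prism_eq_prismAt, prism_eq_prismAt]; exact image_prismAt_of_frame hαt hφ ψ _
  rw [← h1, ← image_cylBall_of_frame hαt hφ ℓ (cylRadMax G φ types ℓ ψ)]
  exact Set.image_mono (prism_subset_cylBall_of_mem_from hκ ht hℓ ψ)

/-- The same containment in the `graphBall ∩ cyl` spelling, `ℓ ≥ ℓ₀`. [folklore] -/
theorem graphBall_inter_cyl_subset_cylBall'_from [G.LocallyFinite] {types : Finset V} {ℓ₀ : ℕ} (hfr : Frames G φ types)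
    (hκ : CylConnFrom G φ types ℓ₀) (c : V) {ℓ : ℕ} (hℓ : ℓ₀ ≤ ℓ) (ψ : ℕ) :
    graphBall G c ψ ∩ cyl φ c ℓ ⊆ cylBall G φ c ℓ (cylRadMax G φ types ℓ ψ) := fun _ hw =>
  prism_subset_cylBall_from hfr hκ c hℓ ψ ⟨hw.1, hw.2⟩

/-- **The graph-ball prism of a NEARBY centre inside a fat prism**, widths `ℓ, m ≥ ℓ₀`. [this work] -/
theorem prism_subset_cylBall_of_near_from [G.LocallyFinite] {types : Finset V} {ℓ₀ : ℕ} (hfr : Frames G φ types)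
    (hκ : CylConnFrom G φ types ℓ₀) {t c' : V} {ℓ m r ψ : ℕ} (hℓ : ℓ₀ ≤ ℓ) (hm : ℓ₀ ≤ m) (hc : c' ∈ graphBall G t r) (hc' : c' ∈ cyl φ t ℓ)
    (hcyl : cyl φ c' m ⊆ cyl φ t ℓ) : prism G φ c' ψ m ⊆ cylBall G φ t ℓ (cylRadMax G φ types ℓ r + cylRadMax G φ types m ψ) :=
  (prism_subset_cylBall_from hfr hκ c' hm ψ).trans
    (cylBall_subset_cylBall_of_mem (prism_subset_cylBall_from hfr hκ t hℓ r ⟨hc, hc'⟩) hcyl)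

/-! ## §2 Exhaustion by fat prisms under (κ′) (`SkelPhiFatRadius.fatSeq_exhaust`, internal width raised by `ℓ₀`) -/

/-- **Exhaustion** (from (κ′)): every vertex lies in some fat prism about a BASE vertex `t`. [folklore] -/
theorem fatSeq_exhaust_from [G.LocallyFinite] [Countable V] {types : Finset V} {ℓ₀ : ℕ} (hκ : CylConnFrom G φ types ℓ₀)
    (hfr : Frames G φ types) {p : unitInterval} (hC : CylSubcritical G φ types p) {t : V} (ht : t ∈ types) (v : V) :
    ∃ n, v ∈ fatSeq hfr hC t n := by
  -- a cylinder of half-width `m ≥ ℓ₀` containing `v`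
  set m : ℕ := (φ v 0 - φ t 0).natAbs + (φ v 1 - φ t 1).natAbs + ℓ₀ with hm
  have hvm : v ∈ cyl φ t m := by
    rw [mem_cyl, mem_box]
    intro i
    simp only [Pi.sub_apply]
    have ha0 := le_abs_self (φ v 0 - φ t 0); have ha0' := neg_abs_le (φ v 0 - φ t 0)
    have ha1 := le_abs_self (φ v 1 - φ t 1); have ha1' := neg_abs_le (φ v 1 - φ t 1)
    have hb0 := abs_nonneg (φ v 0 - φ t 0); have hb1 := abs_nonneg (φ v 1 - φ t 1)
    fin_cases i <;> constructor <;> simp only [hm] <;> push_cast <;> linarith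
  -- a walk in the induced cylinder, by (κ′)
  obtain ⟨wk⟩ := (hκ.connected ht (by omega : ℓ₀ ≤ m)).preconnected ⟨t, self_mem_cyl φ t m⟩ ⟨v, hvm⟩
  refine ⟨max m wk.length, (mem_fatSeq_iff hfr hC).2 ?_⟩
  refine cylBall_mono G φ t (le_max_left _ _) ((le_max_right _ _).trans (le_fatRadius hfr hC _)) ?_
  exact ⟨⟨v, hvm⟩, ⟨wk, le_rfl⟩, rfl⟩

/-! ## §3 Type reach under (κ′) (`SkelPhiTypedCtr.exists_typeReach`, internal width raised by `ℓ₀`) -/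

/-- **Type reach** under (κ′): `k₀ ≥ max(1, ℓ₀)` and `dI` with, for EVERY base vertex `t`, `φ t₀ − φ t ∈ Λ_{k₀}` and `t₀` within induced distance `dI`
of `t` inside `cyl t k₀`. [folklore] -/
theorem exists_typeReach_from {types : Finset V} {ℓ₀ : ℕ} (hκ : CylConnFrom G φ types ℓ₀) (t₀ : V) :
    ∃ k₀ dI : ℕ, 1 ≤ k₀ ∧ ℓ₀ ≤ k₀ ∧ ∀ t ∈ types, φ t₀ - φ t ∈ box 2 k₀ ∧ t₀ ∈ cylBall G φ t k₀ dI := by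
  have hbox : ∀ t ∈ types, ∃ k : ℕ, φ t₀ - φ t ∈ box 2 k := fun t _ => exists_mem_box _
  choose! kt hkt using hbox
  set k₀ : ℕ := types.sup kt + ℓ₀ + 1 with hk₀
  have hk₀t : ∀ t ∈ types, φ t₀ - φ t ∈ box 2 k₀ := fun t ht =>
    box_mono 2 (by have := Finset.le_sup (f := kt) ht; omega) (hkt t ht)
  have hwalk : ∀ t ∈ types, ∃ d : ℕ, t₀ ∈ cylBall G φ t k₀ d := by
    intro t ht
    have hmem : t₀ ∈ cyl φ t k₀ := by rw [mem_cyl]; exact hk₀t t ht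
    obtain ⟨w⟩ := (hκ.connected ht (show ℓ₀ ≤ k₀ by omega)).preconnected ⟨t, self_mem_cyl φ t k₀⟩ ⟨t₀, hmem⟩
    exact ⟨w.length, ⟨⟨t₀, hmem⟩, ⟨w, le_rfl⟩, rfl⟩⟩
  choose! dt hdt using hwalk
  refine ⟨k₀, types.sup dt, by omega, by omega, fun t ht => ⟨hk₀t t ht, ?_⟩⟩
  exact cylBall_mono G φ t le_rfl (Finset.le_sup (f := dt) ht) (hdt t ht)

end Skelφ

/-! ## §4 Bridge: the structure field of `PlanarSkeletonNegFrom` is the dictionary entry -/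

namespace PlanarSkeletonNegFrom

open Literature.Probability.LatticeModels

variable {V : Type} {G : SimpleGraph V} [G.LocallyFinite] (Φ : PlanarSkeletonNegFrom G)

/-- (κ′) of a `PlanarSkeletonNegFrom`, in the φ-level dictionary (the other fields `Φ.lip : Skelφ.Lip G Φ.φ`, `Φ.frame : Skelφ.Frames G Φ.φ Φ.types`,
`Φ.step : Skelφ.Steps G Φ.φ` are literally dictionary entries already). [folklore] -/
theorem cylConnFrom : Skelφ.CylConnFrom G Φ.φ Φ.types Φ.ℓ₀ := Φ.cyl_connected

end PlanarSkeletonNegFrom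

end Summit.CriticalPhenomena.PercolationContinuityZ3.Theorems.Transplant

end
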